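import Literature.NumberTheory.EllipticCurves.Rank1Residual.Typed.KimCertificate
import Literature.NumberTheory.EllipticCurves.Rank1Residual.Typed.X3
import Literature.NumberTheory.EllipticCurves.Rank1Residual.Typed.X4
import HarnessLib

/-!
# Classes X3/X4 (additive `p`): the CLASS-WIDE shape of Kim's Kurihara-number route, its exact
# boundary, and the located gaps (cell `b2b-bsdres`, unit `b2b-bsdres-additive-p3`)

HONEST FRAMING (run/shared/lean/b2b/bsd-rank1-residual/, verbatim in every file): the goal of the
cell is to DELETE the COMBINATION-SHAPED residual classes of the Birch–Swinnerton-Dyer formula for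
ALL analytic-rank `≤ 1` elliptic curves over `ℚ` — "full BSD formula for every rank `≤ 1` curve in
class `C`" assembled STRICTLY from published theorems — so that the rank-`≤ 1` remainder becomes
exactly the CONSTRUCTION-SHAPED classes, which are TYPED (missing-input `Prop`s), NOT attempted.
This is not "finishing BSD". Research route; no claim beyond the stated classes. X3 and X4 stay
CONSTRUCTION-SHAPED; nothing below is a class theorem closing either.

## What this module does (theorems + two typed inputs; no named fact; our own work, hence `Summits/`)

The per-pair Kurihara-number certificates of C.-H. Kim, *The structure of Selmer groups and the
Iwasawa main conjecture for elliptic curves*, Amer. J. Math. 148 (2026) 79–129, Thm. 1.8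
(= arXiv:2203.12159v4 Thm. 1.9), clause (6), hold at ANY reduction type, additive included (tree
named facts `Kim2022_rankZero_padicValRat_sha_of_kuriharaNumber_ne_zero_of_maninConstant` and
`Kim2022_rankOne_card_sha_eq_one_of_kuriharaNumber_ne_zero_of_maninConstant`, file
`Literature/NumberTheory/EllipticCurves/KuriharaNumberKimShaLength.lean`; referee R82.4). Here:

1. **Typed input of the route** (`KuriharaUnitAt`, `KuriharaUnitPrimeAt`): "some mod-`p` Kurihara
   number `δ̃_n`, at a level `n ∈ 𝒩₁(E,p)` all of whose primes `ℓ` have CYCLIC `Ẽ(𝔽_ℓ)[p]`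
   (`#Ẽ(𝔽_ℓ)[p] ≤ p`, the bit the cell's Kurihara lane computes; = Kurihara's / Sakamoto's
   `𝒫_{1,0}`), is a unit" — statement (1) of Kim's Thm. 1.10 (journal; = v4 Thm. 1.11) without its
   `ν(n) = ord(δ̃)` clause, resp. the same at a PRIME level (the rank-one shape).
2. **The exact boundary of the route in analytic rank `0`** (`bsdp_iff_not_dvd_tamagawaProduct_of_kim_rankZero`):
   at ANY `p ≥ 5` with `ρ̄_{E,p}` onto, Kim's Manin hypothesis, the period transfer and ONE unit
   Kurihara number, Miller's `BSD(E,p)` holds IF AND ONLY IF `p ∤ ∏_ℓ c_ℓ(E)`. So on the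
   Tamagawa-obstructed part of X4 a unit Kurihara number REFUTES `BSD(E,p)`
   (`not_kuriharaUnitAt_of_bsdp_of_dvd_tamagawaProduct`: granted `BSD(E,p)`, every cyclic-level
   Kurihara number of such a pair vanishes mod `p` — the criterion fails identically there; this is
   the kernel form of the case `∂^{(∞)}(δ̃) ≥ 1` of Kim's Conjecture 1.9 (journal; v4 Conj. 1.10)
   `∂^{(∞)}(δ̃) = ∑_ℓ ord_p c_ℓ`). The torsion term needs no hypothesis (`ρ̄` onto ⇒ `E[p]`
   irreducible ⇒ `p ∤ #E(ℚ)_tors`, tree). On X4 at `p ≥ 5` the obstruction never comes from the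
   additive prime itself (Kodaira–Néron: `c_p ≤ 4`), only from other bad primes.
3. **Rank `0` closure** (`bsdp_of_kim_rankZero_of_maninConstant`, census shape
   `bsdp_of_kuriharaUnitAt_of_analyticRank_eq_zero`): the additive-`p` consumer asked for in R82.4
   ("a rank-0 consumer of the C105 shape, Summits placement"): X4 ∧ `r_an = 0` ∧ `p ≥ 5` ∧ surj ∧
   Manin ∧ period ∧ `p ∤ ∏ c_ℓ` ∧ `KuriharaUnitAt` ⇒ `BSD(E,p)`.
4. **Rank `1`** (sibling module `X4/KuriharaClasswideRankOne.lean`: `bsdp_iff_padicValRat_eq_zero_of_kim_rankOne`,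
   `bsdp_of_kim_rankOne_of_maninConstant`, census shapes `…_of_kuriharaUnitPrimeAt_…`): a prime-level unit gives
   `Ш(E/ℚ)[p^∞] = 0`, whence `BSD(E,p) ⟺ ord_p #Ш_an = 0` — exact, the remaining input being the
   lane's two-engine value of `#Ш_an` (Gross–Zagier makes it a number; nothing class-wide relates
   `∂^{(1)}(δ̃)` to `L'(E,1)/(Ω·Reg)` at an additive prime: no `p`-adic Gross–Zagier / control there).
5. **Located gap X3** (sibling module: `X3.not_surj`, `X3.kim_hypotheses_unsatisfiable`): every printed Kurihara-number
   theorem (Kim 2026 Thm. 1.8/1.10 and Cor. 1.6; Kim–Nakamura 2020 Thm. 1.6/1.7; Kim–Kim–Sun 2020;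
   Sakamoto 2022; Kurihara 2014) carries "`ρ̄` surjective"; X3 = `red(p) ∧ add(p)` has `E[p]`
   reducible, so the route is EMPTY on X3 (no statement, no certificate). Kim §1.2.5's remark
   ("all the argument works when `ρ̄` is irreducible and there exists a prime `ℓ` exactly dividing
   the conductor such that `ρ̄` is ramified at `ℓ`") concerns small IRREDUCIBLE images (X4 ∧ ¬surj),
   not X3, and is a remark, not typed here.

## The class-wide reading: WHAT UNIFORM HYPOTHESIS makes the criterion hold for every member

Kim 2026, Thm. 1.10 (journal; v4 Thm. 1.11, PDF p. 8, verbatim): "Let `E` be an elliptic curve over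
`ℚ` and `p ≥ 5` a prime such that `ρ̄` is surjective, the Manin constant is prime to `p`,
`E(ℚ_p)[p] = 0`, and all the Tamagawa factors are prime to `p`. Then the following statements are
equivalent. (1) `δ̃^{(1)}_n ≠ 0` in `𝔽_p` for some `n ∈ 𝒩₁` with `ν(n) = ord(δ̃^{(1)})`. (2) The mod
`p` Kato's Kolyvagin system `κ^{Kato,(1)}` is non-trivial. (3) The Iwasawa main conjecture holds."
— with NO hypothesis on the reduction at `p`, "the Iwasawa main conjecture" being Kim's Conj. 1.3,
Kato's main conjecture WITHOUT `p`-adic `L`-functions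
(`char_Λ(H¹_Iw(ℚ,T)/Λκ^{Kato,∞}_1) = char_Λ(Sel₀(ℚ_∞,E[p^∞])^∨)`, PDF p. 5), which makes sense at an
additive prime. CONSEQUENCE for the human's question (unit `additive-p3`): on the sub-class
`X4♮ := X4 ∧ p ≥ 5 ∧ surj(p) ∧ Manin(p) ∧ E(ℚ_p)[p] = 0 ∧ p ∤ ∏ c_ℓ` the uniform hypothesis under
which the Kurihara-unit criterion holds for EVERY member is EXACTLY Kato's integral main conjecture
at `(E, p)` for every member — not merely sufficient but equivalent; hence no weaker uniform
hypothesis exists in print, and none decidable from the grid coordinates (reduction × image × rank ×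
CM × `p`) can exist short of a proof of that main conjecture on the class. At an additive prime the
main conjecture is open class-wide (Kim–Nakamura 2020 Thm. 1.6 derives it FROM a unit Kurihara
number, per pair; Rem. 1.8 (3): "there is neither a Mazur-Greenberg style main conjecture nor a
control theorem for the additive reduction case"; Fouquet–Wan is a preprint). So the class-wide
statement is "BSD(E,p) on X4♮ ∧ r_an = 0 ⟸ Kato's IMC at (E,p)", CONSTRUCTION-SHAPED — consistent
with the X4 label — while PER PAIR the same input is finitely certifiable (one unit `δ̃_n`), which is
why the lane closes pairs (harvest-2 E21: 11 + 26 census pairs, N < 2·10⁴). The typed `Prop` below is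
statement (1) itself (finitary, in the tree's vocabulary); its printed equivalence with (3) is the
citation above (the tree has no vocabulary for `H¹_Iw`/fine Selmer over `ℚ_∞`, so (3) is not
restated). `E(ℚ_p)[p] = 0` (needed by Thm. 1.10, not by Thm. 1.8 (6)) is, at an additive `p ≥ 5`,
exactly "not (`p = 5 ∧ a₄ ≡ 10 (25)`) and not (`p = 7 ∧ a₆ ≡ 14 (49)`)" on the model with
`a_i ∈ pℤ_p` (Kim Prop. 3.2 = Kim–Nakamura Assumption 2.5). The role of the CYCLICITY of the level
primes is proof-level (Mazur–Rubin transversality: `T/(Fr_ℓ−1)T` cyclic, Kim Thm. 2.1), never a class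
restriction: for `ρ̄` onto, the cyclic Kolyvagin primes (`Fr_ℓ` a non-identity unipotent mod `p`)
have positive density for every pair (Chebotarev). Evidence and counts:
`run/shared/lean/b2b/bsd-rank1-residual/b2b-bsdres-additive-p3/KURIHARA-CLASSWIDE.md`.

References: [Kim2022StructureSelmer] Thm. 1.8 (6), Thm. 1.10, Conj. 1.9, Cor. 1.6, §1.2.5, §1.3.5,
Prop. 3.2 (journal numbering; v4 = 1.9/1.11/1.10); [KimNakamura2020] Thm. 1.6/1.7, Rem. 1.8;
[Miller2011LMS] Def. 1.1; Sakamoto, Doc. Math. 27 (2022) Thm. 1.2 (`𝒫_{1,0}`); cell files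
REFEREE.md R82.4, b2b-bsdres-harvest-2/HARVEST.md E20–E21.
-/

noncomputable section

open scoped Classical MatrixGroups ModularForm

open CongruenceSubgroup WeierstrassCurve Literature.NumberTheory.EllipticCurves
  Literature.NumberTheory.EllipticCurves.ModularForms
  Literature.NumberTheory.EllipticCurves.Rank1Residual
  Literature.NumberTheory.EllipticCurves.Rank1Residual.Typed

namespace Summit.BirchSwinnertonDyer.Rank1Residual.X4

/-! ### §1 The typed input of the route (Kim Thm. 1.10 (1), cyclic levels) -/

/-- **Typed input of the Kurihara route at `(E, p)`, any level** — statement (1) of Kim 2026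
Thm. 1.10 (journal; v4 Thm. 1.11) without its `ν(n) = ord(δ̃)` clause, at CYCLIC levels: for the
globally minimal model `W`, the prime `p` and a newform `f` (of `W`), there are a square-free
product `n ∈ 𝒩₁(E,p)` of Kolyvagin primes (`ℓ ∤ N_E p`, `ℓ ≡ 1`, `a_ℓ ≡ ℓ + 1 (mod p)`;
`Kato.IsKolyvaginProduct W p 1 n`) all of whose prime factors have `#Ẽ(𝔽_ℓ)[p] ≤ p` (cyclic
`p`-torsion of the reduction — Kurihara's/Sakamoto's `𝒫_{1,0}`), and surjective discrete logarithms
`ψ_ℓ : (ℤ/ℓ)ˣ ↠ ℤ/p`, with `kuriharaNumber f p n ψ ≠ 0` (a unit mod-`p` Kurihara number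
`δ̃_n^{(1)}`; the choice of `ψ` changes it by a unit). By Kim's Thm. 1.10, under `p ≥ 5`, `ρ̄` onto,
Manin constant prime to `p`, `E(ℚ_p)[p] = 0`, `p ∤ ∏ c_ℓ`, the literal-level version of this `Prop`
is EQUIVALENT to Kato's Iwasawa main conjecture for `(E,p)` (Kim's Conj. 1.3; any reduction type) —
the uniform class hypothesis of the route. For the pair this is KURIHARA'S CONJECTURE (Kurihara,
*Iwasawa Theory 2012*, Contrib. Math. Comput. Sci. 7 (2014) 317–356; restated as Conj. 1.1 of
Sakamoto, Doc. Math. 27 (2022): "There is an integer `d ∈ 𝒩_{1,0}` with `δ̃_d ≠ 0`", `𝒩_{1,0}` =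
square-free products of good `ℓ ≡ 1 (mod p)` with `E(𝔽_ℓ)[p] ≅ 𝔽_p`), open in general (a theorem at
a good ordinary `p` under Sakamoto's (a)–(c) / Kim's Thm. 1.10 hypotheses, where the main conjecture
is known); hence tagged as an open conjecture of our theories. A predicate; nothing asserted.
[cite: Kim2022StructureSelmer, Thm. 1.10 (1) (= arXiv v4 Thm. 1.11, PDF p. 8), §1.2.2, §1.4.3]
[cite: Kurihara2014, §1 (the conjecture on δ̃_d)] [cite: Sakamoto2022pSelmer, Conj. 1.1 and Thm. 1.2] -/
@[conjecture] def KuriharaUnitAt (W : WeierstrassCurve ℚ) [W.IsGloballyMinimal] (p : ℕ) {N : ℕ} [NeZero N]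
    (f : CuspForm (Gamma0 N) 2) : Prop :=
  ∃ (n : ℕ) (_ : NeZero n), Kato.IsKolyvaginProduct W p 1 n ∧
    (∀ (ℓ : ℕ) [Fact ℓ.Prime], ℓ ∣ n →
      Nat.card {P : ((WeierstrassCurve.integralModelInt W).map
          (Int.castRingHom (ZMod ℓ))).toAffine.Point // p • P = 0} ≤ p) ∧
    ∃ ψ : (ℓ : ℕ) → (ZMod ℓ)ˣ →* Multiplicative (ZMod (p ^ 1)),
      (∀ ℓ ∈ n.primeFactors, Function.Surjective (ψ ℓ)) ∧ kuriharaNumber f (p ^ 1) n ψ ≠ 0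

/-- **Typed input of the Kurihara route at `(E, p)`, PRIME level** (the analytic-rank-one shape:
`ord(δ̃) = 1` must be witnessed at `ν(n) = 1`): a Kolyvagin prime `ℓ ∈ 𝒫₁(E,p)`
(`Kato.IsKolyvaginPrime W p 1 ℓ`) with `#Ẽ(𝔽_ℓ)[p] ≤ p` and a surjective discrete logarithm `ψ_ℓ`
with `kuriharaNumber f p ℓ ψ ≠ 0`. Kurihara's conjecture witnessed at `ν = 1` (by Kim Thm. 1.10, under its
hypotheses and `Ш(E/ℚ)[p] = 0`, the witnessing level has `ν(n) = rank E(ℚ)` prime factors); open per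
pair in general. A predicate; nothing asserted.
[cite: Kim2022StructureSelmer, Thm. 1.10 (1) and Thm. 1.8 (1), (4), (6) (journal numbering), §1.2.2, §1.4.3]
[cite: Kurihara2014, §1] [cite: Sakamoto2022pSelmer, Conj. 1.1] -/
@[conjecture] def KuriharaUnitPrimeAt (W : WeierstrassCurve ℚ) [W.IsGloballyMinimal] (p : ℕ) {N : ℕ} [NeZero N]
    (f : CuspForm (Gamma0 N) 2) : Prop :=
  ∃ (ℓ : ℕ) (_ : Fact ℓ.Prime), Kato.IsKolyvaginPrime W p 1 ℓ ∧
    Nat.card {P : ((WeierstrassCurve.integralModelInt W).map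
        (Int.castRingHom (ZMod ℓ))).toAffine.Point // p • P = 0} ≤ p ∧
    ∃ ψ : (ℓ' : ℕ) → (ZMod ℓ')ˣ →* Multiplicative (ZMod (p ^ 1)),
      Function.Surjective (ψ ℓ) ∧ kuriharaNumber f (p ^ 1) ℓ ψ ≠ 0

variable (W : WeierstrassCurve ℚ) [W.IsElliptic] [W.IsGloballyMinimal] (p : ℕ) [Fact p.Prime]

omit [W.IsElliptic] [Fact p.Prime] in
/-- A prime level is a level: `KuriharaUnitPrimeAt ⇒ KuriharaUnitAt` (the square-free product
`n = ℓ`). Bookkeeping. [folklore] -/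
theorem kuriharaUnitAt_of_kuriharaUnitPrimeAt {N : ℕ} [NeZero N] (f : CuspForm (Gamma0 N) 2)
    (h : KuriharaUnitPrimeAt W p f) : KuriharaUnitAt W p f := by
  obtain ⟨ℓ, hℓF, hℓ, hcyc, ψ, hψ, hδ⟩ := h
  have hℓp : ℓ.Prime := hℓ.prime
  haveI : NeZero ℓ := ⟨hℓp.ne_zero⟩
  refine ⟨ℓ, inferInstance, hℓ.isKolyvaginProduct, ?_, ψ, ?_, hδ⟩
  · intro ℓ' _ hdvd
    have hℓ' : ℓ' = ℓ :=
      ((Nat.prime_dvd_prime_iff_eq (Fact.out : ℓ'.Prime) hℓp).mp hdvd)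
    subst hℓ'
    exact hcyc
  · intro ℓ' hmem
    rw [hℓp.primeFactors, Finset.mem_singleton] at hmem
    subst hmem
    exact hψ

/-! ### §2 Analytic rank `0`: the exact boundary `BSD(E,p) ⟺ p ∤ ∏ c_ℓ` under a unit Kurihara number -/

omit [W.IsGloballyMinimal] in
/-- **Bookkeeping behind the boundary.** In analytic rank `0` (`L(E,1) ≠ 0`), with
`rank E(ℚ) = r_an` and `Ш(E/ℚ)` finite (Gross–Zagier–Kolyvagin), `E[p]` irreducible (so
`p ∤ #E(ℚ)_tors`), and the OUTPUT of Kim's clause (6) at a unit Kurihara number —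
`L(E,1)/Ω(W) = q ∈ ℚ` with `ord_p q = ord_p #Ш(E/ℚ)(p)` —: `#Ш_an = q · #E(ℚ)_tors² / ∏ c_ℓ`, so
Miller's `BSD(E,p)` (`ord_p #Ш_an = ord_p #Ш(p)`) holds iff `ord_p ∏ c_ℓ = 0`. Fact-free.
[cite: Miller2011LMS, Def. 1.1 (arXiv:1010.2431 p. 3)] -/
theorem bsdp_iff_not_dvd_tamagawaProduct_of_rankZero_witness
    (hmw : W.mordellWeilRank = W.analyticRank) (hfin : Finite W.sha)
    (hL : W.entireLFunction 1 ≠ 0) (hirr : W.HasIrreducibleModPGaloisRep p) {q : ℚ}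
    (hq : W.entireLFunction 1 / (W.realPeriodRat : ℂ) = (q : ℂ))
    (hval : padicValRat p q =
      (padicValNat p (Nat.card (AddCommGroup.primaryComponent W.sha p)) : ℤ)) :
    BSDp W p ↔ ¬ p ∣ W.tamagawaProduct := by
  have hr0 : W.analyticRank = 0 := analyticRank_eq_zero_of_entireLFunction_one_ne_zero hL
  have hmw0 : W.mordellWeilRank = 0 := by rw [hmw, hr0]
  have hΩpos : 0 < W.realPeriodRat := by
    haveI : (W.baseChange ℝ).IsElliptic := by rw [baseChange]; infer_instance
    exact (W.baseChange ℝ).realPeriod_pos'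
  have hΩ : (W.realPeriodRat : ℂ) ≠ 0 := by exact_mod_cast hΩpos.ne'
  rw [div_eq_iff hΩ] at hq
  have hq0 : q ≠ 0 := by
    rintro rfl
    apply hL
    rw [hq]; simp
  have ht0 : (W.torsionOrder : ℚ) ≠ 0 := by exact_mod_cast (W.torsionOrder_pos_holds).ne'
  have hc0 : (W.tamagawaProduct : ℚ) ≠ 0 := by exact_mod_cast (W.tamagawaProduct_pos').ne'
  -- `#Ш_an = q · #tors² / ∏ c` in analytic rank `0`
  have hsha : shaAn W = ((q * (W.torsionOrder : ℚ) ^ 2 / (W.tamagawaProduct : ℚ) : ℚ) : ℂ) := by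
    have hR : W.regulator = 1 := W.regulator_eq_one_of_rank_zero hmw0
    have hc0' : (W.tamagawaProduct : ℂ) ≠ 0 := by exact_mod_cast (W.tamagawaProduct_pos').ne'
    rw [shaAn_def, WeierstrassCurve.leadingLCoeff, hr0, iteratedDeriv_zero, Nat.factorial_zero,
      Nat.cast_one, div_one, hq, hR]
    push_cast
    field_simp
  -- its valuation: `ord_p q − ord_p ∏ c` (the torsion is prime to `p`)
  have htors0 : padicValNat p W.torsionOrder = 0 :=
    padicValNat_torsionOrder_eq_zero_of_irreducible W p hirr
  have hvq : padicValRat p (q * (W.torsionOrder : ℚ) ^ 2 / (W.tamagawaProduct : ℚ)) =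
      padicValRat p q - padicValNat p W.tamagawaProduct := by
    have h2 : padicValRat p ((W.torsionOrder : ℚ) ^ 2) = 2 * padicValRat p (W.torsionOrder : ℚ) := by
      rw [pow_two, padicValRat.mul ht0 ht0]; ring
    rw [padicValRat.div (mul_ne_zero hq0 (pow_ne_zero 2 ht0)) hc0,
      padicValRat.mul hq0 (pow_ne_zero 2 ht0), h2, padicValRat.of_nat, padicValRat.of_nat, htors0]
    push_cast; ring
  constructor
  · rintro ⟨-, -, q', hq', hv'⟩
    have hqq : q' = q * (W.torsionOrder : ℚ) ^ 2 / (W.tamagawaProduct : ℚ) := by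
      exact_mod_cast hq'.symm.trans hsha
    rw [hqq, hvq, ← hval] at hv'
    have h0 : (padicValNat p W.tamagawaProduct : ℤ) = 0 := by linarith
    have h0' : padicValNat p W.tamagawaProduct = 0 := by exact_mod_cast h0
    rcases padicValNat.eq_zero_iff.mp h0' with h1 | h2 | h3
    · exact absurd h1 (Fact.out : p.Prime).one_lt.ne'
    · exact absurd h2 (W.tamagawaProduct_pos').ne'
    · exact h3
  · intro htam
    haveI : Finite W.sha := hfin
    refine ⟨hmw, inferInstance, q * (W.torsionOrder : ℚ) ^ 2 / (W.tamagawaProduct : ℚ), hsha, ?_⟩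
    rw [hvq, hval, padicValNat.eq_zero_of_not_dvd htam]
    push_cast; ring

/-- **The exact boundary of the Kurihara route in analytic rank `0`, ANY reduction at `p`
(additive included).** Inputs: Kim 2026 Thm. 1.8 (6) in its any-reduction rank-`0` shape (named
fact `hKim` = `Kim2022_rankZero_padicValRat_sha_of_kuriharaNumber_ne_zero_of_maninConstant`) and
Gross–Zagier–Kolyvagin (`hGZK`). Hypotheses, per pair: `p ≥ 5`; `ρ̄_{E,p}` onto; `L(E,1) ≠ 0`; a
modular parametrisation datum `D` of `W` with `p ∤ D.maninConstant` (Kim's hypothesis, needed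
exactly when `p² ∣ N`); the period transfer `Ω(W) = u·Ω⁺_{D.f}`, `|u|_p = 1`; a level `n ∈ 𝒩₁`
with cyclic reductions, surjective discrete logarithms `ψ`, and ONE unit `kuriharaNumber D.f p n ψ`.
Conclusion: `BSD(E,p) ⟺ p ∤ ∏_ℓ c_ℓ`. Reading: the unit certificate closes the pair exactly on the
Tamagawa-prime part and REFUTES `BSD(E,p)` on the Tamagawa-obstructed part — the kernel form of
"a unit `δ̃_n` forces `∂^{(∞)}(δ̃) = 0`, while BSD wants `∂^{(∞)}(δ̃) = ∑ ord_p c_ℓ`" (Kim's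
Conj. 1.9). Per pair; NOT a class theorem.
[cite: Kim2022StructureSelmer, Thm. 1.8 (6) and Conj. 1.9 (journal; = v4 Thm. 1.9 (6), Conj. 1.10, PDF p. 8)]
[cite: Miller2011LMS, Def. 1.1] -/
theorem bsdp_iff_not_dvd_tamagawaProduct_of_kim_rankZero
    (hKim : Kim2022_rankZero_padicValRat_sha_of_kuriharaNumber_ne_zero_of_maninConstant)
    (hGZK : rank_eq_analyticRank_of_analyticRank_le_one) (hp : 5 ≤ p)
    (hsurj : W.HasSurjectiveModNGaloisRep p) (hL : W.entireLFunction 1 ≠ 0)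
    {N : ℕ} [NeZero N] (D : ModularParametrizationData W N) (hc : ¬ (p : ℤ) ∣ D.maninConstant)
    (hper : ∃ u : ℚ, ‖(u : ℚ_[p])‖ = 1 ∧ W.realPeriodRat = u * plusPeriod D.f)
    (n : ℕ) [NeZero n] (hn : Kato.IsKolyvaginProduct W p 1 n)
    (hcyc : ∀ (ℓ : ℕ) [Fact ℓ.Prime], ℓ ∣ n →
      Nat.card {P : ((WeierstrassCurve.integralModelInt W).map
          (Int.castRingHom (ZMod ℓ))).toAffine.Point // p • P = 0} ≤ p)
    (ψ : (ℓ : ℕ) → (ZMod ℓ)ˣ →* Multiplicative (ZMod (p ^ 1)))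
    (hψ : ∀ ℓ ∈ n.primeFactors, Function.Surjective (ψ ℓ))
    (hδ : kuriharaNumber D.f (p ^ 1) n ψ ≠ 0) : BSDp W p ↔ ¬ p ∣ W.tamagawaProduct := by
  have hr0 : W.analyticRank = 0 := analyticRank_eq_zero_of_entireLFunction_one_ne_zero hL
  obtain ⟨hmw, hfin⟩ := hGZK W (by rw [hr0]; exact zero_le_one)
  obtain ⟨q, hq, hval⟩ := hKim W p hp hsurj hL hfin D hc hper n hn hcyc ψ hψ hδ
  exact bsdp_iff_not_dvd_tamagawaProduct_of_rankZero_witness W p hmw hfin hL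
    (hasIrreducibleModPGaloisRep_of_hasSurjectiveModNGaloisRep W p hsurj) hq hval

/-- **Rank-`0` consumer at ANY prime `p ≥ 5`, additive included** (the "C105-shape" consumer
of R82.4): the hypotheses of `bsdp_iff_not_dvd_tamagawaProduct_of_kim_rankZero` plus
`p ∤ ∏_ℓ c_ℓ` give Miller's `BSD(E,p)`. No torsion hypothesis (`ρ̄` onto ⇒ `p ∤ #E(ℚ)_tors`).
Where it bites: the 11 open rank-`0` X4 census pairs at the additive prime `5` with `#Ш_an = 25`,
`5 ∤ ∏ c_ℓ` (harvest-2 E21; two/three-engine unit `δ̃` at `ν(n) = 2` levels). Per pair; NOT a class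
theorem. [cite: Kim2022StructureSelmer, Thm. 1.8 (6) (journal)] [cite: Miller2011LMS, Def. 1.1] -/
theorem bsdp_of_kim_rankZero_of_maninConstant
    (hKim : Kim2022_rankZero_padicValRat_sha_of_kuriharaNumber_ne_zero_of_maninConstant)
    (hGZK : rank_eq_analyticRank_of_analyticRank_le_one) (hp : 5 ≤ p)
    (hsurj : W.HasSurjectiveModNGaloisRep p) (hL : W.entireLFunction 1 ≠ 0)
    {N : ℕ} [NeZero N] (D : ModularParametrizationData W N) (hc : ¬ (p : ℤ) ∣ D.maninConstant)
    (hper : ∃ u : ℚ, ‖(u : ℚ_[p])‖ = 1 ∧ W.realPeriodRat = u * plusPeriod D.f)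
    (htam : ¬ p ∣ W.tamagawaProduct)
    (n : ℕ) [NeZero n] (hn : Kato.IsKolyvaginProduct W p 1 n)
    (hcyc : ∀ (ℓ : ℕ) [Fact ℓ.Prime], ℓ ∣ n →
      Nat.card {P : ((WeierstrassCurve.integralModelInt W).map
          (Int.castRingHom (ZMod ℓ))).toAffine.Point // p • P = 0} ≤ p)
    (ψ : (ℓ : ℕ) → (ZMod ℓ)ˣ →* Multiplicative (ZMod (p ^ 1)))
    (hψ : ∀ ℓ ∈ n.primeFactors, Function.Surjective (ψ ℓ))
    (hδ : kuriharaNumber D.f (p ^ 1) n ψ ≠ 0) : BSDp W p :=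
  (bsdp_iff_not_dvd_tamagawaProduct_of_kim_rankZero W p hKim hGZK hp hsurj hL D hc hper n hn hcyc
    ψ hψ hδ).mpr htam

/-- **The other side of the boundary**: under the same inputs, if `p ∣ ∏_ℓ c_ℓ` then a unit
Kurihara number at a cyclic level is INCOMPATIBLE with `BSD(E,p)`. Per pair.
[cite: Kim2022StructureSelmer, Thm. 1.8 (6) and Conj. 1.9 (journal)] [cite: Miller2011LMS, Def. 1.1] -/
theorem not_bsdp_of_kim_rankZero_of_dvd_tamagawaProduct
    (hKim : Kim2022_rankZero_padicValRat_sha_of_kuriharaNumber_ne_zero_of_maninConstant)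
    (hGZK : rank_eq_analyticRank_of_analyticRank_le_one) (hp : 5 ≤ p)
    (hsurj : W.HasSurjectiveModNGaloisRep p) (hL : W.entireLFunction 1 ≠ 0)
    {N : ℕ} [NeZero N] (D : ModularParametrizationData W N) (hc : ¬ (p : ℤ) ∣ D.maninConstant)
    (hper : ∃ u : ℚ, ‖(u : ℚ_[p])‖ = 1 ∧ W.realPeriodRat = u * plusPeriod D.f)
    (htam : p ∣ W.tamagawaProduct)
    (n : ℕ) [NeZero n] (hn : Kato.IsKolyvaginProduct W p 1 n)
    (hcyc : ∀ (ℓ : ℕ) [Fact ℓ.Prime], ℓ ∣ n →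
      Nat.card {P : ((WeierstrassCurve.integralModelInt W).map
          (Int.castRingHom (ZMod ℓ))).toAffine.Point // p • P = 0} ≤ p)
    (ψ : (ℓ : ℕ) → (ZMod ℓ)ˣ →* Multiplicative (ZMod (p ^ 1)))
    (hψ : ∀ ℓ ∈ n.primeFactors, Function.Surjective (ψ ℓ))
    (hδ : kuriharaNumber D.f (p ^ 1) n ψ ≠ 0) : ¬ BSDp W p := fun hB =>
  (bsdp_iff_not_dvd_tamagawaProduct_of_kim_rankZero W p hKim hGZK hp hsurj hL D hc hper n hn hcyc
    ψ hψ hδ).mp hB htam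

/-! ### §3 Class X4, analytic rank `0`: census shapes over the typed input -/

/-- **X4 ∧ `r_an = 0`: `BSD(E,p) ⟺ p ∤ ∏ c_ℓ` given the typed input `KuriharaUnitAt`** (class
predicate `ClassX4 W p` = `p ≠ 2 ∧ add(p) ∧ irr(p)`; the additive clause is not used by the proof —
Kim's Thm. 1.8 has no reduction hypothesis — and is carried to name the class). Inputs: `hKim`,
`hGZK`, modularity `hmod` (to read `r_an = 0` as `L(E,1) ≠ 0`); per pair `p ≥ 5`, `ρ̄` onto, the
Manin datum, the period transfer. NOT a class theorem (the typed input is per pair; class-wide it is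
Kato's IMC, see the module docstring). [cite: Kim2022StructureSelmer, Thm. 1.8 (6), Thm. 1.10 (journal)]
[cite: Miller2011LMS, Def. 1.1] -/
theorem bsdp_iff_not_dvd_tamagawaProduct_of_kuriharaUnitAt_of_analyticRank_eq_zero
    (hKim : Kim2022_rankZero_padicValRat_sha_of_kuriharaNumber_ne_zero_of_maninConstant)
    (hGZK : rank_eq_analyticRank_of_analyticRank_le_one) (hmod : hasEntireLFunction_rat)
    (hp : 5 ≤ p) (_hX : ClassX4 W p) (hsurj : Surj W p) (hr : W.analyticRank = 0)
    {N : ℕ} [NeZero N] (D : ModularParametrizationData W N) (hc : ¬ (p : ℤ) ∣ D.maninConstant)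
    (hper : ∃ u : ℚ, ‖(u : ℚ_[p])‖ = 1 ∧ W.realPeriodRat = u * plusPeriod D.f)
    (hK : KuriharaUnitAt W p D.f) : BSDp W p ↔ ¬ p ∣ W.tamagawaProduct := by
  obtain ⟨n, hn0, hn, hcyc, ψ, hψ, hδ⟩ := hK
  exact bsdp_iff_not_dvd_tamagawaProduct_of_kim_rankZero W p hKim hGZK hp hsurj
    ((W.analyticRank_eq_zero_iff_holds (hmod W)).mp hr) D hc hper n hn hcyc ψ hψ hδ

/-- **X4 ∧ `r_an = 0` ∧ `p ∤ ∏ c_ℓ`: `BSD(E,p)` from the typed input `KuriharaUnitAt`** — the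
class-wide SHAPE of the Kurihara route in analytic rank `0` ("for every X4 pair with `p ≥ 5`, `ρ̄`
onto, Manin, period, `p ∤ ∏ c_ℓ`: Kim Thm. 1.10 (1) at a cyclic level ⇒ BSD(E,p)"); by Thm. 1.10
the input is, class-wide, Kato's IMC — CONSTRUCTION-SHAPED; X4's label is unchanged.
[cite: Kim2022StructureSelmer, Thm. 1.8 (6), Thm. 1.10 (journal)] [cite: Miller2011LMS, Def. 1.1] -/
theorem bsdp_of_kuriharaUnitAt_of_analyticRank_eq_zero
    (hKim : Kim2022_rankZero_padicValRat_sha_of_kuriharaNumber_ne_zero_of_maninConstant)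
    (hGZK : rank_eq_analyticRank_of_analyticRank_le_one) (hmod : hasEntireLFunction_rat)
    (hp : 5 ≤ p) (hX : ClassX4 W p) (hsurj : Surj W p) (hr : W.analyticRank = 0)
    {N : ℕ} [NeZero N] (D : ModularParametrizationData W N) (hc : ¬ (p : ℤ) ∣ D.maninConstant)
    (hper : ∃ u : ℚ, ‖(u : ℚ_[p])‖ = 1 ∧ W.realPeriodRat = u * plusPeriod D.f)
    (htam : ¬ p ∣ W.tamagawaProduct) (hK : KuriharaUnitAt W p D.f) : BSDp W p :=
  (bsdp_iff_not_dvd_tamagawaProduct_of_kuriharaUnitAt_of_analyticRank_eq_zero W p hKim hGZK hmod hp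
    hX hsurj hr D hc hper hK).mpr htam

/-- **X4 ∧ `r_an = 0` ∧ `p ∣ ∏ c_ℓ`: granted `BSD(E,p)`, the typed input FAILS** — every mod-`p`
Kurihara number at every cyclic level vanishes (for every choice of surjective discrete
logarithms). The located class boundary of the route: the Tamagawa-obstructed part of X4 (harvest-2
E21: 128 of the 139 open rank-`0` `ρ̄`-onto X4 census pairs at `p ≥ 5`, `N < 2·10⁴`) is outside
it, not for want of level search. [cite: Kim2022StructureSelmer, Thm. 1.8 (6) and Conj. 1.9 (journal)]
[cite: Miller2011LMS, Def. 1.1] -/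
theorem not_kuriharaUnitAt_of_bsdp_of_dvd_tamagawaProduct
    (hKim : Kim2022_rankZero_padicValRat_sha_of_kuriharaNumber_ne_zero_of_maninConstant)
    (hGZK : rank_eq_analyticRank_of_analyticRank_le_one) (hmod : hasEntireLFunction_rat)
    (hp : 5 ≤ p) (hX : ClassX4 W p) (hsurj : Surj W p) (hr : W.analyticRank = 0)
    {N : ℕ} [NeZero N] (D : ModularParametrizationData W N) (hc : ¬ (p : ℤ) ∣ D.maninConstant)
    (hper : ∃ u : ℚ, ‖(u : ℚ_[p])‖ = 1 ∧ W.realPeriodRat = u * plusPeriod D.f)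
    (htam : p ∣ W.tamagawaProduct) (hB : BSDp W p) : ¬ KuriharaUnitAt W p D.f := fun hK =>
  (bsdp_iff_not_dvd_tamagawaProduct_of_kuriharaUnitAt_of_analyticRank_eq_zero W p hKim hGZK hmod hp
    hX hsurj hr D hc hper hK).mp hB htam

end Summit.BirchSwinnertonDyer.Rank1Residual.X4

end
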